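import Literature.MathematicalPhysics.QuantumFieldTheory.Balaban1983to89.B9RWSums346MixedFactorAtRecordClosed
import Literature.MathematicalPhysics.QuantumFieldTheory.Balaban1983to89.Node00.Record11
import Literature.MathematicalPhysics.QuantumFieldTheory.Balaban1983to89.B9PinGeometryKLevelV1
import Literature.MathematicalPhysics.QuantumFieldTheory.Balaban1983to89.B9RWSumsDefinitePins
import Literature.MathematicalPhysics.QuantumFieldTheory.Balaban1983to89.B9RWSumsDefinitePinsPairM
import Literature.MathematicalPhysics.QuantumFieldTheory.Balaban1983to89.B7Prop2SpecialUnitary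

/-!
# BalabanUVNodes ∕ N06 ([B9], `Dag.B9_main`) — ROWS 18's THIRD-ORDER MIXED FACTOR (`FactorsL2Mixed37Dir`, the block-`L²` bound of `K(h_□)G′_□h_□∇*_{U,μ}`,
# (3.88)–(3.89) p. 409 with (3.46) p. 398) AT THE WALK-LETTER PINS OF def-Y's MEMBERS: the member-∀ knit of dag-n06-w7's `factorsL2Mixed37Dir_memberY_record_at`
# (named constants `MRec aRec BRec δRec`) into the certificate's binder shape — a hypothesis-form helper for the stage-11 certificate editions ≥ 42

Track A of `YM-PLAN.md` (cell `pub-ymgap`, HUMAN RULING D-0062), node **N06** = [Balaban1985BackgroundPropagators] Thms 3.1–3.15; width seat `pub-ymgap-dag-n06-w7`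
(g2, 2026-08-28), written for the knit seat `pub-ymgap-dag-n06-d` in the pattern of its own helper `BalabanUVNodesN06MixedLegAtPinsPhys` (edition 33).

WHAT.  Rows 18 of the certificate (Theorem 3.7 ∕ Corollary 3.8 for `G′(U)`; edition 41 `…N06AtOpsYNuOfRecordV6EPairNV`) display, as the LAST conjunct of `h36H`, the schema
`FactorsL2Mixed37Dir (𝔬 x) (𝔡 x) (𝔩 x) 1 (H x) pM.θM p.δ₀ U` (n06-k's species `B9Thm37KLetterDir.FactorsL2Mixed37Dir`: `∀ □ μ, BlockBd blk blk ((K(h_□)·G′_□·M_{h_□}) ∘ ∇*_{U,μ})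
(1_{S′_□}(y)·θ_M·(Lʲη)⁻¹·e^{−δ₀d})`, the third-order mixed factor the split (3.88) leaves in the mixed member of (3.46)).  dag-n06-w7 PROVED it from data the certificate ALREADY
DISPLAYS — `Identities₂ (𝔬 x) (𝔡 x) (𝔩 x) 1 (H x) U` (`h36`'s second conjunct), the two letter transposes `∀ q′ μ, IsTransposePair ((𝔩 x).Pt U q′ μ) ((𝔩 x).P U q′ μ)`,
`∀ q′, IsTransposePair ((𝔬 x).Ct U q′) ((𝔬 x).Cop U q′)` (inside `h36H` since edition 40), `hst : StaticOK (𝔬 x) p.ρ p.Nc p.N′ p.Cℓ (κ x)`, `hκ : (κ x).Bounded p.Kc p.θ₀ p.Cℓ M_x`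
— plus the five walk-letter pins `hblkS hhS hGsqF h𝔡d h𝔡s` (the two `L²` legs of `G′_□` being dag-n06-w1's cube estimates read through Parseval, the Lemma-2.1 inputs discharged
at `geo9Y`): `B9RWSums346MixedFactorAtRecordClosed.factorsL2Mixed37Dir_memberY_record_at`, in a regime `MRec ≤ M_x`, `c35Y·M_x·α₀ ≤ aRec`, `U` in (3.35), with the constant
`p.θ₀·e^{(3/4 + ρ′)p.ρ}·BRec` at any target rate `0 ≤ ρ′ ≤ δRec`.  THIS FILE knits it into the certificate's binder shapes:
★★ `factorsL2Mixed37Dir_of_pins` — for every member and every `U` in `h36H`'s OWN regime prefix (`p.M₁ ≤ M_x`, `c35Y·M_x·α₀ ≤ p.a₁`, `Reg335 c35Y α₀ U`) the displayed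
conjunct AT THE DISPLAYED numerics `pM.θM ∕ p.δ₀`, given four numeric side conditions `MRec ≤ p.M₁`, `p.a₁ ≤ aRec`, `p.δ₀ ≤ δRec`, `p.θ₀·e^{(3/4 + p.δ₀)p.ρ}·BRec ≤ pM.θM`,
the pins, `hst hκ hp`, and the three displayed families `hIds hPt hCt`; ★ `h36H_of_mixedFactor` — the edition-41 `h36H` family WITH the mixed factor from the family WITHOUT it +
the derived family (conjuncts abstract; its output is literally the input of n06-d's `N06MixedLegAtPinsPhys.h36H_of_mixed`); ★★ `h36H_with_factor_of_pins` — ONE CALL: from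
`h36` (first conjunct abstract) and the REDUCED `h36H` (last conjunct dropped; transposes concrete, the rest abstract) + pins + numerics, the edition-41-shape `h36H`;
★ `thetaRec_nonneg` — the `hθfac` left side is `≥ 0` (`MixedPrims.OK` asks only `0 ≤ θM`, so a numerics witness may set `pM.θM :=` that term).
HONEST FRAMING.  Kernel bookkeeping (one application of dag-n06-w7's theorem per member and configuration, one kernel domination); COUNT-NEUTRAL; the analytic content
is dag-n06-w1's ∕ dag-n06-w7's landed theorems, consumed by name; `Identities₂`, the two transposes, `StaticOK`, `Sizes.Bounded` stay the certificate's own displayed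
hypotheses; nothing else of [B9] asserted; N06 NOT discharged; K1⁹ NOT closed.  One finite 𝕋⁴ programme at fixed `ε` — NOT continuum, NOT OS, NOT the mass gap ∕ Clay;
no summit statement is proved here.  0 `def`, 0 `sorry`.
-/

noncomputable section

namespace Summit.QuantumFields.YangMills.BalabanUVNodes.N06MixedFactorAtPinsPhys

open Literature.MathematicalPhysics.QuantumFieldTheory.Balaban1983to89
open Literature.MathematicalPhysics.QuantumFieldTheory.Balaban1983to89.Node00 (SiteY FBondY IBondY CfgY etaS parSymY Stage11Params)
open Literature.MathematicalPhysics.QuantumFieldTheory.Balaban1983to89.T4Continuum (T4Family)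
open Literature.MathematicalPhysics.QuantumFieldTheory.Balaban1983to89.B6Ineq2142KLevelV1 (lvl β)
open Literature.MathematicalPhysics.QuantumFieldTheory.Balaban1983to89.B6GlobalChartV1 (blkV1)
open Literature.MathematicalPhysics.QuantumFieldTheory.Balaban1983to89.B6Geom246MultiLevelTorus (geomT)
open Literature.MathematicalPhysics.QuantumFieldTheory.Balaban1983to89.B9Ineq349SiteComposite (cdSL cdsSL)
open Literature.MathematicalPhysics.QuantumFieldTheory.Balaban1983to89.B9CoReadingCoords (coordOpK)
open Literature.MathematicalPhysics.QuantumFieldTheory.Balaban1983to89.B9CoReadingCoordsS (XSK blkSK sIK)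
open Literature.MathematicalPhysics.QuantumFieldTheory.Balaban1983to89.B9CoReadingCoordsTranspose (TrIdx trBasis)
open Literature.MathematicalPhysics.QuantumFieldTheory.Balaban1983to89.B9PinMembersKLevelV1 (MemberY geo9Y bg9Y)
open Literature.MathematicalPhysics.QuantumFieldTheory.Balaban1983to89.B9PinGeometryKLevelV1 (c35Y c35Y_pos)
open Literature.MathematicalPhysics.QuantumFieldTheory.Balaban1983to89.B9GeoNormsKLevelV1 (geo9K_dist_nonneg)
open Literature.MathematicalPhysics.QuantumFieldTheory.Balaban1983to89.B9Thm37Glue (IsTransposePair)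
open Literature.MathematicalPhysics.QuantumFieldTheory.Balaban1983to89.B9Thm37Whole (Ops StaticOK Sizes)
open Literature.MathematicalPhysics.QuantumFieldTheory.Balaban1983to89.B9Thm37WholeDir (DirLetters37 Identities₂)
open Literature.MathematicalPhysics.QuantumFieldTheory.Balaban1983to89.B9Thm37KLetterDir (FactorsL2Mixed37Dir)
open Literature.MathematicalPhysics.QuantumFieldTheory.Balaban1983to89.B9RWSums346SecondDiffGp (DirOps37)
open Literature.MathematicalPhysics.QuantumFieldTheory.Balaban1983to89.B9RWSumsDefinitePins (PinPrims)
open Literature.MathematicalPhysics.QuantumFieldTheory.Balaban1983to89.B9RWSumsDefinitePinsPairM (MixedPrims)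
open Literature.MathematicalPhysics.QuantumFieldTheory.Balaban1983to89.B6Cover236MultiLevelBlocks (cubes)
open Literature.MathematicalPhysics.QuantumFieldTheory.Balaban1983to89.B9WalkLettersCoordsS (hWalkY gsqcoS)
open Literature.MathematicalPhysics.QuantumFieldTheory.Balaban1983to89.B9RWSums346MixedFactorAtPins (factorsL2Mixed37Dir_mono)
open Literature.MathematicalPhysics.QuantumFieldTheory.Balaban1983to89.B9RWSums346MixedFactorAtRecordClosed
  (MRec aRec BRec δRec BRec_pos factorsL2Mixed37Dir_memberY_record_at)
open Literature.MathematicalPhysics.QuantumFieldTheory.Balaban1983to89.B7Prop2SpecialUnitary (specialUnitaryUnits specialUnitaryUnits_le_unitaryUnits)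
open scoped Matrix.Norms.L2Operator

variable {N : ℕ} {F : T4Family}

/-! ## §1 The numerics side: the displayed constant is nonnegative -/

/-- ★ the left side of the certificate's numeric binder `hθfac : p.θ₀·e^{(3/4 + p.δ₀)p.ρ}·BRec ≤ pM.θM` is `≥ 0` whenever `0 ≤ p.θ₀` (`p.OK.θ₀_nn`) — so a numerics witness
may take `pM.θM :=` this term (`MixedPrims.OK` asks only `0 ≤ θM`). [cite: Balaban1985BackgroundPropagators, (3.89) p.409, bookkeeping] -/
theorem thetaRec_nonneg [NeZero N] (θ : Stage11Params F N) (Mstar : ℕ) [∀ x : MemberY θ.d₆ θ.ℓ₆ θ.hd' θ.hL' θ.b₀ θ.b₁ Mstar, Fintype (geo9Y x).Site]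
    {θ₀ δ₀ ρ : ℝ} (hθ₀ : 0 ≤ θ₀) :
    0 ≤ θ₀ * Real.exp ((3 / 4 + δ₀) * ρ) * BRec θ.d₆ θ.ℓ₆ θ.hd' θ.hL' θ.b₀ θ.b₁ Mstar N c35Y c35Y_pos :=
  mul_nonneg (mul_nonneg hθ₀ (Real.exp_nonneg _)) (BRec_pos θ.d₆ θ.ℓ₆ θ.hd' θ.hL' θ.b₀ θ.b₁ Mstar N c35Y c35Y_pos).le

/-! ## §2 At def-Y's members of record: the certificate's binder shape -/

/-- ★★ **THE MIXED FACTOR OF `h36H` AT THE WALK-LETTER PINS** (module docstring): for `ι := cubes`, pins `hblkS hhS hGsqF h𝔡d h𝔡s`, the displayed `hst hκ` (and `hp : p.OK`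
for `0 ≤ p.θ₀`, `1 ≤ p.Cℓ`, `0 < p.δ₀`), the displayed families `hIds` (`h36`'s `Identities₂` conjunct), `hPt hCt` (`h36H`'s transposes), and the numerics `MRec ≤ p.M₁`,
`p.a₁ ≤ aRec`, `p.δ₀ ≤ δRec`, `p.θ₀·e^{(3/4 + p.δ₀)p.ρ}·BRec ≤ pM.θM` — in `h36H`'s regime prefix, `FactorsL2Mixed37Dir (𝔬 x) (𝔡 x) (𝔩 x) 1 (H x) pM.θM p.δ₀ U`.
[cite: Balaban1985BackgroundPropagators, (3.88)–(3.89) p.409, Thm 3.1 (3.46) p.398, Cor 3.6 p.408, (3.35) p.396; Balaban1984PropagatorsII, (2.39)–(2.44) pp.229–230, (2.52)–(2.55) p.232, Lemma 2.1 (2.59)–(2.61) pp.233–234] -/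
theorem factorsL2Mixed37Dir_of_pins [NeZero N] (θ : Stage11Params F N) (Mstar : ℕ)
    [∀ x : MemberY θ.d₆ θ.ℓ₆ θ.hd' θ.hL' θ.b₀ θ.b₁ Mstar, Fintype (geo9Y x).Site] [∀ x : MemberY θ.d₆ θ.ℓ₆ θ.hd' θ.hL' θ.b₀ θ.b₁ Mstar, DecidableEq (geo9Y x).Site]
    (H : MemberY θ.d₆ θ.ℓ₆ θ.hd' θ.hL' θ.b₀ θ.b₁ Mstar → Prop)
    (bI : ∀ x : MemberY θ.d₆ θ.ℓ₆ θ.hd' θ.hL' θ.b₀ θ.b₁ Mstar, FBondY x.toKIdx → IBondY x.toKIdx)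
    (hlev : ∀ (x : MemberY θ.d₆ θ.ℓ₆ θ.hd' θ.hL' θ.b₀ θ.b₁ Mstar) (f : FBondY x.toKIdx), lvl x.hN x.D x.hk (bI x f) = (blkV1 x.hN x.D f).1.1)
    (hβ1 : ∀ (x : MemberY θ.d₆ θ.ℓ₆ θ.hd' θ.hL' θ.b₀ θ.b₁ Mstar) (f : FBondY x.toKIdx), (geomT x.D).dist (β x.hN x.D x.hk (bI x f)) (blkV1 x.hN x.D f) ≤ 1)
    (𝔬 : ∀ x : MemberY θ.d₆ θ.ℓ₆ θ.hd' θ.hL' θ.b₀ θ.b₁ Mstar, Ops (geo9Y x) (bg9Y (Matrix (Fin N) (Fin N) ℂ) (specialUnitaryUnits (Fin N)) x) (XSK (TrIdx N) x.toKIdx) (XSK (TrIdx N) x.toKIdx) ↥(cubes x.toKIdx.D.toDomains))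
    (𝔡 : ∀ x : MemberY θ.d₆ θ.ℓ₆ θ.hd' θ.hL' θ.b₀ θ.b₁ Mstar, DirOps37 (𝔬 x) (Fin (θ.d₆ + 1)))
    (𝔩 : ∀ x : MemberY θ.d₆ θ.ℓ₆ θ.hd' θ.hL' θ.b₀ θ.b₁ Mstar, DirLetters37 (𝔬 x) (Fin (θ.d₆ + 1)))
    (hblkS : ∀ x : MemberY θ.d₆ θ.ℓ₆ θ.hd' θ.hL' θ.b₀ θ.b₁ Mstar, (𝔬 x).blk = blkSK x.toKIdx (sIK x.toKIdx (bI x)))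
    (hhS : ∀ (x : MemberY θ.d₆ θ.ℓ₆ θ.hd' θ.hL' θ.b₀ θ.b₁ Mstar) (c : ↥(cubes x.toKIdx.D.toDomains)), (𝔬 x).h c = hWalkY x c)
    (hGsqF : ∀ (x : MemberY θ.d₆ θ.ℓ₆ θ.hd' θ.hL' θ.b₀ θ.b₁ Mstar) (U : (bg9Y (Matrix (Fin N) (Fin N) ℂ) (specialUnitaryUnits (Fin N)) x).Cfg) (c : ↥(cubes x.toKIdx.D.toDomains)),
      (𝔬 x).Gsq U c = gsqcoS x (trBasis N) (bg9Y (Matrix (Fin N) (Fin N) ℂ) (specialUnitaryUnits (Fin N)) x) (fun U => U) (parSymY x.toKIdx) c U)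
    (h𝔡d : ∀ (x : MemberY θ.d₆ θ.ℓ₆ θ.hd' θ.hL' θ.b₀ θ.b₁ Mstar) (U : (bg9Y (Matrix (Fin N) (Fin N) ℂ) (specialUnitaryUnits (Fin N)) x).Cfg),
      (𝔡 x).Dd U = fun μ => (etaS x.toKIdx)⁻¹ • coordOpK (trBasis N) (fun _ : Fin (θ.d₆ + 1) => (cdSL x.toKIdx U μ).restrictScalars ℝ))
    (h𝔡s : ∀ (x : MemberY θ.d₆ θ.ℓ₆ θ.hd' θ.hL' θ.b₀ θ.b₁ Mstar) (U : (bg9Y (Matrix (Fin N) (Fin N) ℂ) (specialUnitaryUnits (Fin N)) x).Cfg),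
      (𝔡 x).Dsd U = fun μ => (etaS x.toKIdx)⁻¹ • coordOpK (trBasis N) (fun _ : Fin (θ.d₆ + 1) => (cdsSL x.toKIdx U μ).restrictScalars ℝ))
    (p : PinPrims) (hp : p.OK) (pM : MixedPrims) (κ : MemberY θ.d₆ θ.ℓ₆ θ.hd' θ.hL' θ.b₀ θ.b₁ Mstar → Sizes)
    (hst : ∀ x, StaticOK (𝔬 x) p.ρ p.Nc p.N' p.Cℓ (κ x)) (hκ : ∀ x, (κ x).Bounded p.Kc p.θ₀ p.Cℓ (geo9Y x).M)
    -- the three displayed families (`h36`'s `Identities₂` conjunct; `h36H`'s two letter transposes, editions ≥ 40), in `h36H`'s regime prefix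
    (hIds : ∀ x : MemberY θ.d₆ θ.ℓ₆ θ.hd' θ.hL' θ.b₀ θ.b₁ Mstar, p.M₁ ≤ (geo9Y x).M → ∀ α₀ : ℝ, 0 < α₀ → c35Y * (geo9Y x).M * α₀ ≤ p.a₁ →
      ∀ U : (bg9Y (Matrix (Fin N) (Fin N) ℂ) (specialUnitaryUnits (Fin N)) x).Cfg, (bg9Y (Matrix (Fin N) (Fin N) ℂ) (specialUnitaryUnits (Fin N)) x).Reg335 c35Y α₀ U →
        Identities₂ (𝔬 x) (𝔡 x) (𝔩 x) 1 (H x) U)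
    (hPt : ∀ x : MemberY θ.d₆ θ.ℓ₆ θ.hd' θ.hL' θ.b₀ θ.b₁ Mstar, p.M₁ ≤ (geo9Y x).M → ∀ α₀ : ℝ, 0 < α₀ → c35Y * (geo9Y x).M * α₀ ≤ p.a₁ →
      ∀ U : (bg9Y (Matrix (Fin N) (Fin N) ℂ) (specialUnitaryUnits (Fin N)) x).Cfg, (bg9Y (Matrix (Fin N) (Fin N) ℂ) (specialUnitaryUnits (Fin N)) x).Reg335 c35Y α₀ U →
        ∀ q' μ, IsTransposePair ((𝔩 x).Pt U q' μ) ((𝔩 x).P U q' μ))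
    (hCt : ∀ x : MemberY θ.d₆ θ.ℓ₆ θ.hd' θ.hL' θ.b₀ θ.b₁ Mstar, p.M₁ ≤ (geo9Y x).M → ∀ α₀ : ℝ, 0 < α₀ → c35Y * (geo9Y x).M * α₀ ≤ p.a₁ →
      ∀ U : (bg9Y (Matrix (Fin N) (Fin N) ℂ) (specialUnitaryUnits (Fin N)) x).Cfg, (bg9Y (Matrix (Fin N) (Fin N) ℂ) (specialUnitaryUnits (Fin N)) x).Reg335 c35Y α₀ U →
        ∀ q', IsTransposePair ((𝔬 x).Ct U q') ((𝔬 x).Cop U q'))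
    -- the four numeric side conditions at the NAMED constants of `B9RWSums346MixedFactorAtRecordClosed`
    (hM1 : MRec θ.d₆ θ.ℓ₆ θ.hd' θ.hL' θ.b₀ θ.b₁ Mstar N c35Y c35Y_pos ≤ p.M₁) (ha1 : p.a₁ ≤ aRec θ.d₆ θ.ℓ₆ θ.hd' θ.hL' θ.b₀ θ.b₁ Mstar N c35Y c35Y_pos)
    (hδ1 : p.δ₀ ≤ δRec θ.d₆ θ.ℓ₆ θ.hd' θ.hL' θ.b₀ θ.b₁ Mstar N c35Y c35Y_pos)
    (hθ1 : p.θ₀ * Real.exp ((3 / 4 + p.δ₀) * p.ρ) * BRec θ.d₆ θ.ℓ₆ θ.hd' θ.hL' θ.b₀ θ.b₁ Mstar N c35Y c35Y_pos ≤ pM.θM) :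
    ∀ x : MemberY θ.d₆ θ.ℓ₆ θ.hd' θ.hL' θ.b₀ θ.b₁ Mstar, p.M₁ ≤ (geo9Y x).M → ∀ α₀ : ℝ, 0 < α₀ → c35Y * (geo9Y x).M * α₀ ≤ p.a₁ →
      ∀ U : (bg9Y (Matrix (Fin N) (Fin N) ℂ) (specialUnitaryUnits (Fin N)) x).Cfg, (bg9Y (Matrix (Fin N) (Fin N) ℂ) (specialUnitaryUnits (Fin N)) x).Reg335 c35Y α₀ U →
        FactorsL2Mixed37Dir (𝔬 x) (𝔡 x) (𝔩 x) 1 (H x) pM.θM p.δ₀ U := fun x hM α₀ hα ha U hU =>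
  factorsL2Mixed37Dir_mono (𝔬 x) (𝔡 x) (𝔩 x) U (thetaRec_nonneg θ Mstar hp.θ₀_nn) hθ1 le_rfl (fun a b => geo9K_dist_nonneg x.toKIdx a b) (hst x).lenpos
    (factorsL2Mixed37Dir_memberY_record_at θ.d₆ θ.ℓ₆ θ.hd' θ.hL' θ.b₀ θ.b₁ Mstar N c35Y c35Y_pos specialUnitaryUnits_le_unitaryUnits x (hM1.trans hM) α₀ hα (ha.trans ha1) U hU
      (hlev x) (hβ1 x) (H x) (𝔬 x) (𝔡 x) (𝔩 x) (hblkS x) (hhS x) (hGsqF x U) (fun ν => congrFun (h𝔡d x U) ν) (fun μ => congrFun (h𝔡s x U) μ)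
      (hst x) (hκ x) hp.θ₀_nn hp.one_le_Cℓ (hIds x hM α₀ hα ha U hU) (hPt x hM α₀ hα ha U hU) (hCt x hM α₀ hα ha U hU) hp.δ₀_pos.le hδ1)

/-! ## §3 Recombination into the edition-41 shape of `h36H` -/

/-- ★ **`h36H` WITH the mixed factor FROM `h36H` WITHOUT it + the derived factor family** (conjuncts abstract; same regime prefix; the output shape is exactly the input of
n06-d's `N06MixedLegAtPinsPhys.h36H_of_mixed`). [cite: Balaban1985BackgroundPropagators, (3.88)–(3.89) p.409, bookkeeping] -/
theorem h36H_of_mixedFactor {d ℓ : ℕ} {hd : 1 ≤ d + 1} {hL : Odd (ℓ + 1) ∧ 1 < ℓ + 1} {b₀ b₁ : ℝ} {Mstar : ℕ}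
    {M₁ a₁ c : ℝ} {P₁ P₂ P₃ P₄ P₅ P₆ P₈ : ∀ x : MemberY d ℓ hd hL b₀ b₁ Mstar, (bg9Y (Matrix (Fin N) (Fin N) ℂ) (specialUnitaryUnits (Fin N)) x).Cfg → Prop}
    (h36H : ∀ x : MemberY d ℓ hd hL b₀ b₁ Mstar, M₁ ≤ (geo9Y x).M → ∀ α₀ : ℝ, 0 < α₀ → c * (geo9Y x).M * α₀ ≤ a₁ →
      ∀ U : (bg9Y (Matrix (Fin N) (Fin N) ℂ) (specialUnitaryUnits (Fin N)) x).Cfg, (bg9Y (Matrix (Fin N) (Fin N) ℂ) (specialUnitaryUnits (Fin N)) x).Reg335 c α₀ U →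
        P₁ x U ∧ P₂ x U ∧ (P₃ x U ∧ P₄ x U) ∧ (P₅ x U ∧ P₆ x U))
    (hf : ∀ x : MemberY d ℓ hd hL b₀ b₁ Mstar, M₁ ≤ (geo9Y x).M → ∀ α₀ : ℝ, 0 < α₀ → c * (geo9Y x).M * α₀ ≤ a₁ →
      ∀ U : (bg9Y (Matrix (Fin N) (Fin N) ℂ) (specialUnitaryUnits (Fin N)) x).Cfg, (bg9Y (Matrix (Fin N) (Fin N) ℂ) (specialUnitaryUnits (Fin N)) x).Reg335 c α₀ U → P₈ x U) :
    ∀ x : MemberY d ℓ hd hL b₀ b₁ Mstar, M₁ ≤ (geo9Y x).M → ∀ α₀ : ℝ, 0 < α₀ → c * (geo9Y x).M * α₀ ≤ a₁ →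
      ∀ U : (bg9Y (Matrix (Fin N) (Fin N) ℂ) (specialUnitaryUnits (Fin N)) x).Cfg, (bg9Y (Matrix (Fin N) (Fin N) ℂ) (specialUnitaryUnits (Fin N)) x).Reg335 c α₀ U →
        P₁ x U ∧ P₂ x U ∧ (P₃ x U ∧ P₄ x U) ∧ (P₅ x U ∧ P₆ x U) ∧ P₈ x U := fun x hM α₀ hα ha U hU => by
  obtain ⟨h₁, h₂, h₃₄, h₅₆⟩ := h36H x hM α₀ hα ha U hU
  exact ⟨h₁, h₂, h₃₄, h₅₆, hf x hM α₀ hα ha U hU⟩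

/-- ★★ **ONE CALL FOR THE KNIT: THE EDITION-41-SHAPE `h36H` FROM `h36` AND THE REDUCED `h36H`** — `h36 : … → L x U ∧ Identities₂ (𝔬 x) (𝔡 x) (𝔩 x) 1 (H x) U` (first conjunct
abstract) and the reduced `h36H″ : … → P₁ ∧ P₂ ∧ (P₃ ∧ (Pᵗ∕P transposes) ∧ (Cᵗ∕C transposes)) ∧ (P₅ ∧ P₆)` (the displayed `FactorsL2Mixed37Dir` conjunct DROPPED) plus the
pins, `hst hκ hp` and the four numerics give back `h36H` in the edition-41 shape `… ∧ (P₅ ∧ P₆) ∧ FactorsL2Mixed37Dir (𝔬 x) (𝔡 x) (𝔩 x) 1 (H x) pM.θM p.δ₀ U` — the term the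
certificate feeds to `h36H_of_mixed` today. [cite: Balaban1985BackgroundPropagators, (3.88)–(3.89) p.409, (3.46) p.398, Cor 3.6 p.408, bookkeeping] -/
theorem h36H_with_factor_of_pins [NeZero N] (θ : Stage11Params F N) (Mstar : ℕ)
    [∀ x : MemberY θ.d₆ θ.ℓ₆ θ.hd' θ.hL' θ.b₀ θ.b₁ Mstar, Fintype (geo9Y x).Site] [∀ x : MemberY θ.d₆ θ.ℓ₆ θ.hd' θ.hL' θ.b₀ θ.b₁ Mstar, DecidableEq (geo9Y x).Site]
    (H : MemberY θ.d₆ θ.ℓ₆ θ.hd' θ.hL' θ.b₀ θ.b₁ Mstar → Prop)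
    (bI : ∀ x : MemberY θ.d₆ θ.ℓ₆ θ.hd' θ.hL' θ.b₀ θ.b₁ Mstar, FBondY x.toKIdx → IBondY x.toKIdx)
    (hlev : ∀ (x : MemberY θ.d₆ θ.ℓ₆ θ.hd' θ.hL' θ.b₀ θ.b₁ Mstar) (f : FBondY x.toKIdx), lvl x.hN x.D x.hk (bI x f) = (blkV1 x.hN x.D f).1.1)
    (hβ1 : ∀ (x : MemberY θ.d₆ θ.ℓ₆ θ.hd' θ.hL' θ.b₀ θ.b₁ Mstar) (f : FBondY x.toKIdx), (geomT x.D).dist (β x.hN x.D x.hk (bI x f)) (blkV1 x.hN x.D f) ≤ 1)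
    (𝔬 : ∀ x : MemberY θ.d₆ θ.ℓ₆ θ.hd' θ.hL' θ.b₀ θ.b₁ Mstar, Ops (geo9Y x) (bg9Y (Matrix (Fin N) (Fin N) ℂ) (specialUnitaryUnits (Fin N)) x) (XSK (TrIdx N) x.toKIdx) (XSK (TrIdx N) x.toKIdx) ↥(cubes x.toKIdx.D.toDomains))
    (𝔡 : ∀ x : MemberY θ.d₆ θ.ℓ₆ θ.hd' θ.hL' θ.b₀ θ.b₁ Mstar, DirOps37 (𝔬 x) (Fin (θ.d₆ + 1)))
    (𝔩 : ∀ x : MemberY θ.d₆ θ.ℓ₆ θ.hd' θ.hL' θ.b₀ θ.b₁ Mstar, DirLetters37 (𝔬 x) (Fin (θ.d₆ + 1)))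
    (hblkS : ∀ x : MemberY θ.d₆ θ.ℓ₆ θ.hd' θ.hL' θ.b₀ θ.b₁ Mstar, (𝔬 x).blk = blkSK x.toKIdx (sIK x.toKIdx (bI x)))
    (hhS : ∀ (x : MemberY θ.d₆ θ.ℓ₆ θ.hd' θ.hL' θ.b₀ θ.b₁ Mstar) (c : ↥(cubes x.toKIdx.D.toDomains)), (𝔬 x).h c = hWalkY x c)
    (hGsqF : ∀ (x : MemberY θ.d₆ θ.ℓ₆ θ.hd' θ.hL' θ.b₀ θ.b₁ Mstar) (U : (bg9Y (Matrix (Fin N) (Fin N) ℂ) (specialUnitaryUnits (Fin N)) x).Cfg) (c : ↥(cubes x.toKIdx.D.toDomains)),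
      (𝔬 x).Gsq U c = gsqcoS x (trBasis N) (bg9Y (Matrix (Fin N) (Fin N) ℂ) (specialUnitaryUnits (Fin N)) x) (fun U => U) (parSymY x.toKIdx) c U)
    (h𝔡d : ∀ (x : MemberY θ.d₆ θ.ℓ₆ θ.hd' θ.hL' θ.b₀ θ.b₁ Mstar) (U : (bg9Y (Matrix (Fin N) (Fin N) ℂ) (specialUnitaryUnits (Fin N)) x).Cfg),
      (𝔡 x).Dd U = fun μ => (etaS x.toKIdx)⁻¹ • coordOpK (trBasis N) (fun _ : Fin (θ.d₆ + 1) => (cdSL x.toKIdx U μ).restrictScalars ℝ))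
    (h𝔡s : ∀ (x : MemberY θ.d₆ θ.ℓ₆ θ.hd' θ.hL' θ.b₀ θ.b₁ Mstar) (U : (bg9Y (Matrix (Fin N) (Fin N) ℂ) (specialUnitaryUnits (Fin N)) x).Cfg),
      (𝔡 x).Dsd U = fun μ => (etaS x.toKIdx)⁻¹ • coordOpK (trBasis N) (fun _ : Fin (θ.d₆ + 1) => (cdsSL x.toKIdx U μ).restrictScalars ℝ))
    (p : PinPrims) (hp : p.OK) (pM : MixedPrims) (κ : MemberY θ.d₆ θ.ℓ₆ θ.hd' θ.hL' θ.b₀ θ.b₁ Mstar → Sizes)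
    (hst : ∀ x, StaticOK (𝔬 x) p.ρ p.Nc p.N' p.Cℓ (κ x)) (hκ : ∀ x, (κ x).Bounded p.Kc p.θ₀ p.Cℓ (geo9Y x).M)
    {L P₁ P₂ P₃ P₅ P₆ : ∀ x : MemberY θ.d₆ θ.ℓ₆ θ.hd' θ.hL' θ.b₀ θ.b₁ Mstar, (bg9Y (Matrix (Fin N) (Fin N) ℂ) (specialUnitaryUnits (Fin N)) x).Cfg → Prop}
    (h36 : ∀ x : MemberY θ.d₆ θ.ℓ₆ θ.hd' θ.hL' θ.b₀ θ.b₁ Mstar, p.M₁ ≤ (geo9Y x).M → ∀ α₀ : ℝ, 0 < α₀ → c35Y * (geo9Y x).M * α₀ ≤ p.a₁ →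
      ∀ U : (bg9Y (Matrix (Fin N) (Fin N) ℂ) (specialUnitaryUnits (Fin N)) x).Cfg, (bg9Y (Matrix (Fin N) (Fin N) ℂ) (specialUnitaryUnits (Fin N)) x).Reg335 c35Y α₀ U →
        L x U ∧ Identities₂ (𝔬 x) (𝔡 x) (𝔩 x) 1 (H x) U)
    (h36H : ∀ x : MemberY θ.d₆ θ.ℓ₆ θ.hd' θ.hL' θ.b₀ θ.b₁ Mstar, p.M₁ ≤ (geo9Y x).M → ∀ α₀ : ℝ, 0 < α₀ → c35Y * (geo9Y x).M * α₀ ≤ p.a₁ →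
      ∀ U : (bg9Y (Matrix (Fin N) (Fin N) ℂ) (specialUnitaryUnits (Fin N)) x).Cfg, (bg9Y (Matrix (Fin N) (Fin N) ℂ) (specialUnitaryUnits (Fin N)) x).Reg335 c35Y α₀ U →
        P₁ x U ∧ P₂ x U ∧ (P₃ x U ∧ (∀ q' μ, IsTransposePair ((𝔩 x).Pt U q' μ) ((𝔩 x).P U q' μ)) ∧ (∀ q', IsTransposePair ((𝔬 x).Ct U q') ((𝔬 x).Cop U q'))) ∧
          (P₅ x U ∧ P₆ x U))
    (hM1 : MRec θ.d₆ θ.ℓ₆ θ.hd' θ.hL' θ.b₀ θ.b₁ Mstar N c35Y c35Y_pos ≤ p.M₁) (ha1 : p.a₁ ≤ aRec θ.d₆ θ.ℓ₆ θ.hd' θ.hL' θ.b₀ θ.b₁ Mstar N c35Y c35Y_pos)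
    (hδ1 : p.δ₀ ≤ δRec θ.d₆ θ.ℓ₆ θ.hd' θ.hL' θ.b₀ θ.b₁ Mstar N c35Y c35Y_pos)
    (hθ1 : p.θ₀ * Real.exp ((3 / 4 + p.δ₀) * p.ρ) * BRec θ.d₆ θ.ℓ₆ θ.hd' θ.hL' θ.b₀ θ.b₁ Mstar N c35Y c35Y_pos ≤ pM.θM) :
    ∀ x : MemberY θ.d₆ θ.ℓ₆ θ.hd' θ.hL' θ.b₀ θ.b₁ Mstar, p.M₁ ≤ (geo9Y x).M → ∀ α₀ : ℝ, 0 < α₀ → c35Y * (geo9Y x).M * α₀ ≤ p.a₁ →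
      ∀ U : (bg9Y (Matrix (Fin N) (Fin N) ℂ) (specialUnitaryUnits (Fin N)) x).Cfg, (bg9Y (Matrix (Fin N) (Fin N) ℂ) (specialUnitaryUnits (Fin N)) x).Reg335 c35Y α₀ U →
        P₁ x U ∧ P₂ x U ∧ (P₃ x U ∧ (∀ q' μ, IsTransposePair ((𝔩 x).Pt U q' μ) ((𝔩 x).P U q' μ)) ∧ (∀ q', IsTransposePair ((𝔬 x).Ct U q') ((𝔬 x).Cop U q'))) ∧
          (P₅ x U ∧ P₆ x U) ∧ FactorsL2Mixed37Dir (𝔬 x) (𝔡 x) (𝔩 x) 1 (H x) pM.θM p.δ₀ U :=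
  h36H_of_mixedFactor (P₄ := fun x U => (∀ q' μ, IsTransposePair ((𝔩 x).Pt U q' μ) ((𝔩 x).P U q' μ)) ∧ (∀ q', IsTransposePair ((𝔬 x).Ct U q') ((𝔬 x).Cop U q')))
    h36H
    (factorsL2Mixed37Dir_of_pins θ Mstar H bI hlev hβ1 𝔬 𝔡 𝔩 hblkS hhS hGsqF h𝔡d h𝔡s p hp pM κ hst hκ
      (fun x hM α₀ hα ha U hU => (h36 x hM α₀ hα ha U hU).2)
      (fun x hM α₀ hα ha U hU => (h36H x hM α₀ hα ha U hU).2.2.1.2.1)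
      (fun x hM α₀ hα ha U hU => (h36H x hM α₀ hα ha U hU).2.2.1.2.2) hM1 ha1 hδ1 hθ1)

end Summit.QuantumFields.YangMills.BalabanUVNodes.N06MixedFactorAtPinsPhys

end
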